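import Mathlib
import Literature.Computability.AlgebraicComplexity.SchoenhageTau
import Literature.Computability.AlgebraicComplexity.BorderRankRestriction
import Literature.Computability.AlgebraicComplexity.StrassenMinimalBorderRank
import Literature.Computability.AlgebraicComplexity.BorderApolarityLimits
import Literature.Computability.AlgebraicComplexity.TensorApolarityForms

/-!
# Weak border apolarity in bi-degrees `(1,1,0)`, `(2,1,0)`, `(1,2,0)` (Conner–Harper–Landsberg 2023, §2.3, §3)

Topic `Literature/Computability/AlgebraicComplexity`. For a 3-tensor `t : ι → κ → μ → K` (the
`κ`-, `μ`-slots are the `A`, `B` of the source, `ι` the `C`) and the tree's algebraic border rank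
(`algBorderRank`, Bläser 2013 Def. 6.1, approximate decompositions over `K[ε]`), we PROVE the part
of the border apolarity necessary conditions of CHL 2023 (§2.3 (i)–(iii) and the `(210)`/`(120)`
tests of §3 (i)) that lives in bi-degrees `(1,1,0)`, `(2,1,0)`, `(1,2,0)`, WITHOUT the
Borel-fixedness (iv) (vocabulary: `TensorApolarityForms.lean`; limits: `BorderApolarityLimits.lean`):

* `TensorApolarity.weak_apolarity_of_decomposition` — given an order-`h` approximate decomposition
  of `t` with `r` triads whose moving points are in general position for `(2,1,0)`- and
  `(1,2,0)`-forms (non-vanishing `r × r` minors; every decomposition can be perturbed into such a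
  one, `BorderApolarityGeneric.lean`, which concludes `exists_subspace_of_algBorderRank_le` from
  `bR(t) ≤ r ≤ |κ|·|μ|`), there is a subspace `F` of bilinear forms on `A × B` (`κ × μ → K`) with
  1. `F ⊆ t(C^*)^⊥` (`slicePerp t`; CHL (i) `I₁₁₀ ⊂ T(C^*)^⊥`),
  2. `dim F ≥ |κ||μ| - r` (CHL (ii), the half that holds unconditionally),
  3. `dim (F·A^* + Alt) ≤ |κ|²|μ| - r` and `dim (F·B^* + Alt) ≤ |κ||μ|² - r` (CHL (ii)+(iii) in
     degrees `(210)`, `(120)` for points in general position: `I₁₁₀ · A^* ⊂ I₂₁₀`, `codim I₂₁₀ = r`;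
     `(2,1,0)`-forms are unsymmetrised arrays, `F·A^* = prodA F`, `Alt = altA` vanishes on points).

Proof (CHL §2.2–2.3 made algebraic over `K[ε]`, `L = K(ε)`): the forms vanishing at the moving
points `(v_ρ(ε), w_ρ(ε))` are the `L`-subspaces `vanishingL` (`TensorApolarityForms.lean`),
`F := lim_{ε→0} I₁₁₀(ε)` is `limSub` (`BorderApolarityLimits.lean`), products of vanishing forms and
alternating arrays vanish in degree `(2,1,0)`/`(1,2,0)`, constant terms commute with products, and the
dimension counts are `finrank_limSub_eq` with rank–nullity over the field `L` (the minor gives `r`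
independent columns of the evaluation map).

## References

* A. Conner, A. Harper, J. M. Landsberg, *New lower bounds for matrix multiplication and `det₃`*,
  Forum Math. Pi 11 (2023) e17, arXiv:1911.07981: §2.2, §2.3 (i)–(iii), §3 (i). [ConnerHarperLandsberg2023]
* M. Bläser, *Fast Matrix Multiplication*, Theory of Computing Graduate Surveys 5 (2013), Def. 6.1. [Blaser2013]
-/

noncomputable section

open Polynomial Module
open scoped Polynomial BigOperators

namespace Literature.Computability.AlgebraicComplexity

namespace TensorApolarity

universe u

variable {K : Type u} [Field K] (L : Type u) [Field L] [Algebra K[X] L] [IsFractionRing K[X] L]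
variable {ι κ μ : Type} [Fintype ι] [Fintype κ] [Fintype μ] [DecidableEq ι] [DecidableEq κ]
  [DecidableEq μ]

/-! ## Dimension of the spaces of vanishing forms over `L = K(ε)` -/

section Dim

variable {σ : Type} [Fintype σ] [DecidableEq σ] {r : ℕ}

omit [IsFractionRing K[X] L] [DecidableEq σ] in
/-- `|σ| ≤ dim_L I(ε) + r`: at most `r` conditions are imposed. [cite: ConnerHarperLandsberg2023, §2.3] -/
theorem card_le_finrank_vanishingL_add (P : Fin r → σ → K[X]) :
    Fintype.card σ ≤ finrank L (vanishingL L P) + r := by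
  have h := LinearMap.finrank_range_add_finrank_ker (evalL L P)
  have hr : finrank L (LinearMap.range (evalL L P)) ≤ r := by
    calc finrank L (LinearMap.range (evalL L P)) ≤ finrank L (Fin r → L) := Submodule.finrank_le _
      _ = r := by simp
  rw [vanishingL]
  have : finrank L (σ → L) = Fintype.card σ := by simp
  omega

/-- If some `r × r` minor of the point matrix is non-zero (columns `cols`), the `r` points impose
independent conditions: `dim_L I(ε) + r ≤ |σ|` ("if the `r` points are in general position,
then `codim I_{ijk,t} = r`"). [cite: ConnerHarperLandsberg2023, §2.3] -/
theorem finrank_vanishingL_add_le (P : Fin r → σ → K[X]) (cols : Fin r → σ)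
    (hdet : (Matrix.of fun ρ ρ' : Fin r => P ρ (cols ρ')).det ≠ 0) :
    finrank L (vanishingL L P) + r ≤ Fintype.card σ := by
  classical
  set Q : Matrix (Fin r) (Fin r) L :=
    (Matrix.of fun ρ ρ' : Fin r => P ρ (cols ρ')).map (algebraMap K[X] L) with hQ
  have hQdet : Q.det ≠ 0 := by
    have hmap : Q.det = algebraMap K[X] L (Matrix.of fun ρ ρ' : Fin r => P ρ (cols ρ')).det := by
      rw [hQ, RingHom.map_det, RingHom.mapMatrix_apply]
    rw [hmap]
    exact fun h => hdet ((IsFractionRing.to_map_eq_zero_iff (K := L)).1 h)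
  -- the columns of `Q` are the values of `evalL` on coordinate vectors
  have hcol : ∀ ρ', Q.col ρ' = evalL L P (Pi.single (cols ρ') 1) := by
    intro ρ'
    funext ρ
    simp [hQ, Matrix.col, Pi.single_apply, Finset.sum_ite_eq']
  have hli : LinearIndependent L Q.col := Matrix.linearIndependent_cols_of_det_ne_zero hQdet
  set g : Fin r → LinearMap.range (evalL L P) :=
    fun ρ' => ⟨evalL L P (Pi.single (cols ρ') 1), LinearMap.mem_range_self _ _⟩ with hg
  have hg' : LinearIndependent L g := by
    apply LinearIndependent.of_comp (LinearMap.range (evalL L P)).subtype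
    have : (LinearMap.range (evalL L P)).subtype ∘ g = Q.col := by
      funext ρ'
      simp [hg, hcol]
    rw [this]
    exact hli
  have hle : r ≤ finrank L (LinearMap.range (evalL L P)) := by
    simpa using hg'.fintype_card_le_finrank
  have h := LinearMap.finrank_range_add_finrank_ker (evalL L P)
  have : finrank L (σ → L) = Fintype.card σ := by simp
  rw [vanishingL]
  omega

end Dim

/-! ## The limit of `I₁₁₀(ε)` and its products -/

section Points

variable {r : ℕ} {v : Fin r → κ → K[X]} {w : Fin r → μ → K[X]}

omit [Fintype ι] [DecidableEq ι] [Fintype μ] [DecidableEq μ] in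
/-- `∑_k e_x(k) g(k) = g(x)`. [folklore] -/
theorem sum_single_one_mul {R : Type*} [CommRing R] (x : κ) (g : κ → R) :
    ∑ k, (Pi.single x (1 : R) : κ → R) k * g k = g x := by
  rw [Finset.sum_eq_single x]
  · simp
  · intro k _ hk
    simp [hk]
  · intro h
    exact absurd (Finset.mem_univ x) h

omit [Fintype ι] [DecidableEq ι] [Fintype κ] [DecidableEq κ] in
/-- `∑_m e_y(m) g(m) = g(y)`. [folklore] -/
theorem sum_single_one_mul' {R : Type*} [CommRing R] (y : μ) (g : μ → R) :
    ∑ m, (Pi.single y (1 : R) : μ → R) m * g m = g y := by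
  rw [Finset.sum_eq_single y]
  · simp
  · intro m _ hm
    simp [hm]
  · intro h
    exact absurd (Finset.mem_univ y) h

omit [Fintype ι] [DecidableEq ι] [DecidableEq μ] in
/-- `f ∈ I₁₁₀(ε)` implies `f · e_x ∈ I₂₁₀(ε)`. [cite: ConnerHarperLandsberg2023, §2.3 (iii)] -/
theorem mulA_mem_latt_pt₂ {f : κ × μ → K[X]} (hf : f ∈ latt K L (vanishingL L (pt₁ v w)))
    (x : κ) : mulA f (Pi.single x 1) ∈ latt K L (vanishingL L (pt₂ v w)) := by
  rw [mem_latt_vanishingL_iff] at hf ⊢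
  intro ρ
  have h := hf ρ
  simp only [pt₁] at h
  -- `∑_{k,k',m} (f(k,m)δ_{k'x} + f(k',m)δ_{kx}) v_k v_{k'} w_m = 2 v_x ∑_{k,m} f(k,m) v_k w_m`
  have h1 : ∑ p : κ × (κ × μ), f (p.1, p.2.2) * (Pi.single x (1 : K[X]) : κ → K[X]) p.2.1 *
      pt₂ v w ρ p = v ρ x * ∑ q : κ × μ, f q * (v ρ q.1 * w ρ q.2) := by
    rw [Fintype.sum_equiv ((Equiv.prodAssoc κ κ μ).symm.trans
      (((Equiv.prodComm κ κ).prodCongr (Equiv.refl μ)).trans (Equiv.prodAssoc κ κ μ))) _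
      (fun q : κ × (κ × μ) => (Pi.single x (1 : K[X]) : κ → K[X]) q.1 *
        (v ρ q.1 * (f q.2 * (v ρ q.2.1 * w ρ q.2.2))))]
    · rw [Fintype.sum_prod_type]
      dsimp only
      simp only [← Finset.mul_sum, sum_single_one_mul]
    · rintro ⟨k, k', m⟩
      simp only [pt₂, Equiv.trans_apply, Equiv.prodAssoc_symm_apply, Equiv.prodCongr_apply,
        Prod.map, Equiv.prodComm_apply, Prod.swap_prod_mk, Equiv.refl_apply,
        Equiv.prodAssoc_apply]
      ring
  have h2 : ∑ p : κ × (κ × μ), (Pi.single x (1 : K[X]) : κ → K[X]) p.1 *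
      (f (p.2.1, p.2.2) * pt₂ v w ρ p) = v ρ x * ∑ q : κ × μ, f q * (v ρ q.1 * w ρ q.2) := by
    rw [Fintype.sum_prod_type]
    dsimp only
    have inner : ∀ k : κ, ∑ q : κ × μ, (Pi.single x (1 : K[X]) : κ → K[X]) k *
        (f (q.1, q.2) * pt₂ v w ρ (k, q)) =
        (Pi.single x (1 : K[X]) : κ → K[X]) k *
          (v ρ k * ∑ q : κ × μ, f q * (v ρ q.1 * w ρ q.2)) := by
      intro k
      rw [Finset.mul_sum, Finset.mul_sum]
      refine Finset.sum_congr rfl ?_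
      rintro ⟨k', m⟩ _
      simp only [pt₂]
      ring
    rw [Finset.sum_congr rfl fun k _ => inner k, sum_single_one_mul]
  calc ∑ p : κ × (κ × μ), mulA f (Pi.single x 1) p * pt₂ v w ρ p
      = ∑ p : κ × (κ × μ), (f (p.1, p.2.2) * (Pi.single x (1 : K[X]) : κ → K[X]) p.2.1 *
          pt₂ v w ρ p + (Pi.single x (1 : K[X]) : κ → K[X]) p.1 *
          (f (p.2.1, p.2.2) * pt₂ v w ρ p)) := by
        refine Finset.sum_congr rfl ?_
        rintro ⟨k, k', m⟩ _
        simp only [mulA_apply]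
        ring
    _ = 0 := by rw [Finset.sum_add_distrib, h1, h2, h]; ring

omit [Fintype ι] [DecidableEq ι] [DecidableEq κ] in
/-- `f ∈ I₁₁₀(ε)` implies `f · e_y ∈ I₁₂₀(ε)`. [cite: ConnerHarperLandsberg2023, §2.3 (iii)] -/
theorem mulB_mem_latt_pt₃ {f : κ × μ → K[X]} (hf : f ∈ latt K L (vanishingL L (pt₁ v w)))
    (y : μ) : mulB f (Pi.single y 1) ∈ latt K L (vanishingL L (pt₃ v w)) := by
  rw [mem_latt_vanishingL_iff] at hf ⊢
  intro ρ
  have h := hf ρ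
  simp only [pt₁] at h
  have h1 : ∑ p : κ × (μ × μ), f (p.1, p.2.1) * (Pi.single y (1 : K[X]) : μ → K[X]) p.2.2 *
      pt₃ v w ρ p = w ρ y * ∑ q : κ × μ, f q * (v ρ q.1 * w ρ q.2) := by
    rw [Fintype.sum_equiv ((Equiv.prodAssoc κ μ μ).symm.trans (Equiv.prodComm (κ × μ) μ)) _
      (fun q : μ × (κ × μ) => (Pi.single y (1 : K[X]) : μ → K[X]) q.1 *
        (w ρ q.1 * (f q.2 * (v ρ q.2.1 * w ρ q.2.2))))]
    · rw [Fintype.sum_prod_type]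
      dsimp only
      simp only [← Finset.mul_sum, sum_single_one_mul']
    · rintro ⟨k, m, m'⟩
      simp only [pt₃, Equiv.trans_apply, Equiv.prodAssoc_symm_apply, Equiv.prodComm_apply,
        Prod.swap_prod_mk]
      ring
  have h2 : ∑ p : κ × (μ × μ), f (p.1, p.2.2) * (Pi.single y (1 : K[X]) : μ → K[X]) p.2.1 *
      pt₃ v w ρ p = w ρ y * ∑ q : κ × μ, f q * (v ρ q.1 * w ρ q.2) := by
    rw [Fintype.sum_equiv (((Equiv.refl κ).prodCongr (Equiv.prodComm μ μ)).trans
      ((Equiv.prodAssoc κ μ μ).symm.trans (Equiv.prodComm (κ × μ) μ))) _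
      (fun q : μ × (κ × μ) => (Pi.single y (1 : K[X]) : μ → K[X]) q.1 *
        (w ρ q.1 * (f q.2 * (v ρ q.2.1 * w ρ q.2.2))))]
    · rw [Fintype.sum_prod_type]
      dsimp only
      simp only [← Finset.mul_sum, sum_single_one_mul']
    · rintro ⟨k, m, m'⟩
      simp only [pt₃, Equiv.trans_apply, Equiv.prodCongr_apply, Prod.map, Equiv.refl_apply,
        Equiv.prodComm_apply, Prod.swap_prod_mk, Equiv.prodAssoc_symm_apply]
      ring
  calc ∑ p : κ × (μ × μ), mulB f (Pi.single y 1) p * pt₃ v w ρ p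
      = ∑ p : κ × (μ × μ), (f (p.1, p.2.1) * (Pi.single y (1 : K[X]) : μ → K[X]) p.2.2 *
          pt₃ v w ρ p + f (p.1, p.2.2) * (Pi.single y (1 : K[X]) : μ → K[X]) p.2.1 *
          pt₃ v w ρ p) := by
        refine Finset.sum_congr rfl ?_
        rintro ⟨k, m, m'⟩ _
        simp only [mulB_apply]
        ring
    _ = 0 := by rw [Finset.sum_add_distrib, h1, h2, h]; ring

omit [Fintype ι] [DecidableEq ι] [DecidableEq κ] [DecidableEq μ] in
/-- Alternating constant arrays lie in `I₂₁₀(ε)` (they vanish identically on points). [folklore] -/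
theorem const_mem_latt_pt₂_of_mem_altA {g : κ × (κ × μ) → K} (hg : g ∈ altA K κ μ) :
    (fun p => C (g p)) ∈ latt K L (vanishingL L (pt₂ v w)) := by
  classical
  rw [mem_latt_vanishingL_iff]
  intro ρ
  obtain ⟨hanti, hdiag⟩ := hg
  -- pair `(k,k')` with `(k',k)`
  refine Finset.sum_involution (fun q _ => (q.2.1, (q.1, q.2.2))) ?_ ?_ ?_ ?_
  · rintro ⟨k, k', m⟩ _
    simp only [pt₂]
    rw [hanti k k' m, map_neg]
    ring
  · rintro ⟨k, k', m⟩ _ hne heq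
    simp only [Prod.mk.injEq] at heq
    obtain ⟨rfl, -, -⟩ := heq
    exact hne (by simp [hdiag])
  · intro q _
    exact Finset.mem_univ _
  · rintro ⟨k, k', m⟩ _
    rfl

omit [Fintype ι] [DecidableEq ι] [DecidableEq κ] [DecidableEq μ] in
/-- Alternating constant arrays lie in `I₁₂₀(ε)`. [folklore] -/
theorem const_mem_latt_pt₃_of_mem_altB {g : κ × (μ × μ) → K} (hg : g ∈ altB K κ μ) :
    (fun p => C (g p)) ∈ latt K L (vanishingL L (pt₃ v w)) := by
  classical
  rw [mem_latt_vanishingL_iff]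
  intro ρ
  obtain ⟨hanti, hdiag⟩ := hg
  refine Finset.sum_involution (fun q _ => (q.1, (q.2.2, q.2.1))) ?_ ?_ ?_ ?_
  · rintro ⟨k, m, m'⟩ _
    simp only [pt₃]
    rw [hanti k m m', map_neg]
    ring
  · rintro ⟨k, m, m'⟩ _ hne heq
    simp only [Prod.mk.injEq] at heq
    obtain ⟨-, rfl, -⟩ := heq
    exact hne (by simp [hdiag])
  · intro q _
    exact Finset.mem_univ _
  · rintro ⟨k, m, m'⟩ _
    rfl

omit [Fintype ι] [DecidableEq ι] [Fintype κ] [Fintype μ] [DecidableEq μ] in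
/-- Constant terms commute with the product by a coordinate covector. [folklore] -/
theorem ev0_mulA_single (f : κ × μ → K[X]) (x : κ) :
    ev0ₗ (mulA f (Pi.single x (1 : K[X]))) = mulA (ev0ₗ f) (Pi.single x (1 : K)) := by
  ext ⟨k, k', m⟩
  simp only [ev0ₗ_apply, mulA_apply, Pi.single_apply]
  split_ifs <;> simp

omit [Fintype ι] [DecidableEq ι] [Fintype κ] [Fintype μ] [DecidableEq κ] in
/-- Constant terms commute with the product by a coordinate covector. [folklore] -/
theorem ev0_mulB_single (f : κ × μ → K[X]) (y : μ) :
    ev0ₗ (mulB f (Pi.single y (1 : K[X]))) = mulB (ev0ₗ f) (Pi.single y (1 : K)) := by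
  ext ⟨k, m, m'⟩
  simp only [ev0ₗ_apply, mulB_apply, Pi.single_apply]
  split_ifs <;> simp

omit [Fintype ι] [DecidableEq ι] [DecidableEq κ] [DecidableEq μ] in
/-- **`lim I₁₁₀(ε) ⊆ t(C^*)^⊥`**: a bilinear form vanishing at the moving points of an approximate
decomposition of `t` annihilates, in the limit `ε → 0`, every `ι`-slice of `t`.
[cite: ConnerHarperLandsberg2023, §2.3 (i)] -/
theorem limSub_pt₁_le_slicePerp {h : ℕ} {t : ι → κ → μ → K} {u : Fin r → ι → K[X]}
    (hd : IsApproxDecomposition h t u v w) :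
    limSub K L (vanishingL L (pt₁ v w)) ≤ slicePerp t := by
  intro x hx
  obtain ⟨f, hf, rfl⟩ := (mem_limSub_iff (K := K) L).1 hx
  rw [mem_latt_vanishingL_iff] at hf
  choose Q hQ using (isApproxDecomposition_iff.1 hd)
  intro a
  have hzero : ∑ p : κ × μ, f p * (X ^ h * Q a p.1 p.2) = 0 := by
    calc ∑ p : κ × μ, f p * (X ^ h * Q a p.1 p.2)
        = ∑ p : κ × μ, f p * ∑ ρ, u ρ a * v ρ p.1 * w ρ p.2 := by
          refine Finset.sum_congr rfl fun p _ => ?_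
          rw [(hQ a p.1 p.2).1]
      _ = ∑ ρ, u ρ a * ∑ p : κ × μ, f p * pt₁ v w ρ p := by
          simp only [pt₁, Finset.mul_sum]
          rw [Finset.sum_comm]
          refine Finset.sum_congr rfl fun ρ _ => Finset.sum_congr rfl fun p _ => ?_
          ring
      _ = 0 := by simp [hf]
  have hzero' : ∑ p : κ × μ, f p * Q a p.1 p.2 = 0 := by
    have : (X : K[X]) ^ h * ∑ p : κ × μ, f p * Q a p.1 p.2 = 0 := by
      rw [Finset.mul_sum, ← hzero]
      refine Finset.sum_congr rfl fun p _ => ?_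
      ring
    exact (mul_eq_zero.1 this).resolve_left (pow_ne_zero _ X_ne_zero)
  have := congrArg (fun p : K[X] => p.coeff 0) hzero'
  simp only [Polynomial.finsetSum_coeff, Polynomial.mul_coeff_zero, coeff_zero] at this
  simpa only [ev0ₗ_apply, (hQ a _ _).2] using this

omit [Fintype ι] [DecidableEq ι] [DecidableEq μ] in
/-- **`lim I₁₁₀ · A^* + Alt ⊆ lim I₂₁₀`**. [cite: ConnerHarperLandsberg2023, §2.3 (iii)] -/
theorem prodA_sup_altA_le_limSub :
    prodA (limSub K L (vanishingL L (pt₁ v w))) ⊔ altA K κ μ ≤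
      limSub K L (vanishingL L (pt₂ v w)) := by
  refine sup_le (prodA_le_iff.2 fun x hx k => ?_) fun g hg => ?_
  · obtain ⟨f, hf, rfl⟩ := (mem_limSub_iff (K := K) L).1 hx
    rw [← ev0_mulA_single]
    exact ev0_mem_limSub L (mulA_mem_latt_pt₂ L hf k)
  · refine (mem_limSub_iff (K := K) L).2 ⟨fun p => C (g p), const_mem_latt_pt₂_of_mem_altA L hg, ?_⟩
    exact ev0ₗ_C_comp g

omit [Fintype ι] [DecidableEq ι] [DecidableEq κ] in
/-- **`lim I₁₁₀ · B^* + Alt ⊆ lim I₁₂₀`**. [cite: ConnerHarperLandsberg2023, §2.3 (iii)] -/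
theorem prodB_sup_altB_le_limSub :
    prodB (limSub K L (vanishingL L (pt₁ v w))) ⊔ altB K κ μ ≤
      limSub K L (vanishingL L (pt₃ v w)) := by
  refine sup_le (prodB_le_iff.2 fun x hx y => ?_) fun g hg => ?_
  · obtain ⟨f, hf, rfl⟩ := (mem_limSub_iff (K := K) L).1 hx
    rw [← ev0_mulB_single]
    exact ev0_mem_limSub L (mulB_mem_latt_pt₃ L hf y)
  · refine (mem_limSub_iff (K := K) L).2 ⟨fun p => C (g p), const_mem_latt_pt₃_of_mem_altB L hg, ?_⟩
    exact ev0ₗ_C_comp g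

omit [Fintype ι] [DecidableEq ι] in
/-- **Weak border apolarity, bi-degrees `(110)`, `(210)`, `(120)`**, for a given approximate
decomposition whose moving points are in general position for `(2,1,0)`- and `(1,2,0)`-forms
(non-vanishing `r × r` minors): `F = lim_{ε→0} I₁₁₀(ε)` satisfies `F ⊆ t(C^*)^⊥`,
`dim F ≥ |κ||μ| - r`, `dim(F·A^* + Alt) ≤ |κ|²|μ| - r`, `dim(F·B^* + Alt) ≤ |κ||μ|² - r`.
[cite: ConnerHarperLandsberg2023, §2.3 (i)–(iii) and §3 (i)] -/
theorem weak_apolarity_of_decomposition {h : ℕ} {t : ι → κ → μ → K} {u : Fin r → ι → K[X]}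
    (hd : IsApproxDecomposition h t u v w)
    (cols₂ : Fin r → κ × (κ × μ))
    (hdet₂ : (Matrix.of fun ρ ρ' : Fin r => pt₂ v w ρ (cols₂ ρ')).det ≠ 0)
    (cols₃ : Fin r → κ × (μ × μ))
    (hdet₃ : (Matrix.of fun ρ ρ' : Fin r => pt₃ v w ρ (cols₃ ρ')).det ≠ 0) :
    ∃ F : Submodule K (κ × μ → K), F ≤ slicePerp t ∧
      Fintype.card κ * Fintype.card μ - r ≤ finrank K F ∧
      finrank K ↥(prodA F ⊔ altA K κ μ) ≤ Fintype.card κ * (Fintype.card κ * Fintype.card μ) - r ∧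
      finrank K ↥(prodB F ⊔ altB K κ μ) ≤ Fintype.card κ * (Fintype.card μ * Fintype.card μ) - r := by
  let L := FractionRing K[X]
  refine ⟨limSub K L (vanishingL L (pt₁ v w)), limSub_pt₁_le_slicePerp L hd, ?_, ?_, ?_⟩
  · rw [finrank_limSub_eq]
    have := card_le_finrank_vanishingL_add L (pt₁ v w)
    simp only [Fintype.card_prod] at this
    omega
  · calc finrank K ↥(prodA (limSub K L (vanishingL L (pt₁ v w))) ⊔ altA K κ μ)
        ≤ finrank K (limSub K L (vanishingL L (pt₂ v w))) :=
          Submodule.finrank_mono (prodA_sup_altA_le_limSub L)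
      _ = finrank L (vanishingL L (pt₂ v w)) := finrank_limSub_eq K L _
      _ ≤ Fintype.card (κ × (κ × μ)) - r := by
          have := finrank_vanishingL_add_le L _ cols₂ hdet₂
          omega
      _ = _ := by simp [Fintype.card_prod]
  · calc finrank K ↥(prodB (limSub K L (vanishingL L (pt₁ v w))) ⊔ altB K κ μ)
        ≤ finrank K (limSub K L (vanishingL L (pt₃ v w))) :=
          Submodule.finrank_mono (prodB_sup_altB_le_limSub L)
      _ = finrank L (vanishingL L (pt₃ v w)) := finrank_limSub_eq K L _
      _ ≤ Fintype.card (κ × (μ × μ)) - r := by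
          have := finrank_vanishingL_add_le L _ cols₃ hdet₃
          omega
      _ = _ := by simp [Fintype.card_prod]

end Points

end TensorApolarity

end Literature.Computability.AlgebraicComplexity

end
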